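import Literature.NumberTheory.Automorphic.ResGLnCoeffModuleAdmissibleForm
import HarnessLib

/-!
# The matrix of `dE_λ(X)` in the orthonormal tensor basis of `E_λ(ℂ)` is hermitian for hermitian `X`

Topic `NumberTheory/Automorphic`; namespace `Literature.NumberTheory.Automorphic.AdmissibleForm`.
Theorems only (no definition, no named fact, no `sorry`); a small companion of
`ResGLnCoeffModuleAdmissibleForm` used when the `(𝔤, K_∞)`-cohomology of `GL_n` with coefficients in
`E_λ(ℂ)` is read in coordinates: `archBasis_repr_archCoeffLie_of_hermitian` — in the tensor basis
`archBasis` (orthonormal for the admissible form `archForm`, `basisForm_basis`) the matrix of the Leibniz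
differential `dE_λ(X)` is hermitian when `X ∈ 𝔤𝔩_n(K_∞)` is hermitian
(`archForm_archCoeffLie_left_of_hermitian`). [cite: BorelWallach2000, II §2.2]

## References

* A. Borel, N. Wallach, *Continuous cohomology, discrete subgroups, and representations of reductive
  groups*, 2nd ed. (2000), II §2.2. [BorelWallach2000]
-/

noncomputable section

open scoped ComplexConjugate Matrix Classical
open NumberField NumberField.mixedEmbedding

namespace Literature.NumberTheory.Automorphic

namespace AdmissibleForm

/-- **The matrix of `dE(X)` in the orthonormal tensor basis `archBasis` is hermitian for hermitian `X`**
(admissibility of `E_λ(ℂ)`: `⟨dE(X) v, w⟩ = ⟨v, dE(X) w⟩`, `archForm_archCoeffLie_left_of_hermitian`, and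
`archBasis` is orthonormal for `archForm`). [cite: BorelWallach2000, II §2.2] -/
theorem archBasis_repr_archCoeffLie_of_hermitian {n : ℕ} {K : Type} [Field K] [NumberField K]
    (lam : (K →+* ℂ) → Fin n → ℤ) {X : (archGroupGL n K).lie}
    (hX : (X : Matrix (Fin n) (Fin n) (mixedSpace K))ᴴ = X) (k k' : ∀ τ : K →+* ℂ,
      Fin (Module.finrank ℂ (GLnCohomology.CoeffModule ℂ n (lam τ)))) :
    (AdmissibleForm.archBasis n K lam).repr (ResGLnCohomology.archCoeffLie n K lam X (AdmissibleForm.archBasis n K lam k')) k =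
      conj ((AdmissibleForm.archBasis n K lam).repr
        (ResGLnCohomology.archCoeffLie n K lam X (AdmissibleForm.archBasis n K lam k)) k') := by
  set bE := AdmissibleForm.archBasis n K lam with hbE
  have hleft : ∀ v, AdmissibleForm.archForm n K lam (bE k) v = bE.repr v k := fun v => by
    rw [AdmissibleForm.archForm, AdmissibleForm.basisForm_apply, AdmissibleForm.stdForm_apply, ← hbE, bE.repr_self]
    rw [Finset.sum_eq_single k (fun i _ hi => by rw [Finsupp.single_apply, if_neg (Ne.symm hi), map_zero, zero_mul])
      (fun hk => absurd (Finset.mem_univ k) hk), Finsupp.single_apply, if_pos rfl, map_one, one_mul]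
  have hright : ∀ v, AdmissibleForm.archForm n K lam v (bE k') = conj (bE.repr v k') := fun v => by
    rw [AdmissibleForm.archForm, AdmissibleForm.basisForm_apply, AdmissibleForm.stdForm_apply, ← hbE, bE.repr_self]
    rw [Finset.sum_eq_single k' (fun i _ hi => by rw [Finsupp.single_apply, if_neg (Ne.symm hi), mul_zero])
      (fun hk => absurd (Finset.mem_univ k') hk), Finsupp.single_apply, if_pos rfl, mul_one]
  rw [← hleft, ← AdmissibleForm.archForm_archCoeffLie_left_of_hermitian n K lam hX, hright]

end AdmissibleForm

end Literature.NumberTheory.Automorphic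

end
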